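import Literature.NumberTheory.EllipticCurves.GreenbergVatsal2000.EisensteinCongruenceResidual
import HarnessLib

/-!
# Greenberg–Vatsal 2000, §3 Thm. (3.11) + (28) + p. 43 (with §2 pp. 28–29) IN THE PRINTED SETTING
# — a GOOD ORDINARY Eisenstein prime: for the non-primitive Mazur–Swinnerton-Dyer `p`-adic
# `L`-function `L_{Σ₀}(E/ℚ,T)`, `μ = 0` and `λ = dim H¹(ℚ_Σ/ℚ_∞, Φ) + dim U`

HONEST FRAMING (BSD rank-`≤ 1` residual cell `b2b-bsdres`, home
`run/shared/lean/b2b/bsd-rank1-residual/`, unit `b2b-bsdres-eisenstein-p2`, classes X1/X2): the cell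
deletes the COMBINATION-SHAPED residual classes of the rank-`≤ 1` BSD formula from PUBLISHED
theorems only and TYPES the construction-shaped ones; this is not "finishing BSD". This file records
ONE published statement as a named fact (`def … : Prop`, nothing asserted; D-0014/D-0026): the
GOOD ORDINARY twin of the sibling reading-fact
`nonPrimitive_unitContent_and_lambda_eq_residual_of_lineRamifiedEven`
(`EisensteinCongruenceResidual.lean`, which transcribes the MULTIPLICATIVE case `p ‖ N` of the same
printed theorem and carries the line `-- TODO(general form): … and for good ordinary p as well`).
The present file is that general form at `χ = 1` in the case Greenberg–Vatsal PRINT AS THE MAIN CASE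
(`(p, M) = 1` in the proof of Thm. (3.11): "then our contention follows immediately from the
`q`-expansion principle"): the ANALYTIC input of the cell's kernel derivation of GV Thm. (1.3) in
its own printed setting (the `E`-side, display (16) at a good ordinary prime, is the kernel theorem
`Summit.…X2.ResidualDevissageGoodOrdinary.natCard_line_mul_quotSelmer_eq_of_goodOrd`).

## Citation header (held text arXiv:math/9906215 = `paper:arxiv-math_9906215`; p0055 = p. 32,
## p0065 = p. 42, p0066 = p. 43, p0027 = p. 3, p0032 = p. 9, p0051–52 = pp. 28–29)

* p. 3, display (3): "Suppose that `E` is a modular elliptic curve over `ℚ`, and that `p` is a prime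
  of good ordinary reduction. … Let `Ω_E` denote the real Néron period for `E`. … Mazur and
  Swinnerton-Dyer have constructed an element `L(E/ℚ,T) ∈ Λ ⊗ ℚ_p` satisfying a certain
  interpolation property … `L(E/ℚ, ζ−1) = τ(ρ⁻¹) α_p^{−m} p^m L(E/ℚ,ρ,1)/Ω_E` (3) … `α_p` denotes the
  eigenvalue for Frobenius acting on the maximal (1-dimensional) unramified quotient" — the tree's
  `padicLFunction f (unitRoot W p)` rescaled by `ϖ`, `ϖ·Ω_E = Ω⁺_f` (as in the sibling fact
  `GreenbergVatsal2000.thm13_charIdeal_eq_of_gvPar` and in `Wuthrich2014.charIdeal_dvd_padicLFunction`).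
* §3 p. 32: "Let `E` be a modular elliptic curve of conductor `N`, and let `p` be a fixed odd prime.
  We assume that `E` has either good ordinary or multiplicative reduction at `p`, corresponding to
  the two cases `(N, p) = 1` and `(p, N/p) = 1` respectively".
* p. 42: "We assume that `ψ` is odd and unramified at `p`, or equivalently that `φ` is even and
  ramified at `p`. In this case, the admissible sign is plus, and the canonical period is the real
  period of `E` (up to multiplication by a `p`-adic unit). Let `N` denote the level of `E` and let
  `Σ₀` denote any set of primes containing all primes `l ≠ p` dividing `N`, but not including `p`.
  … Then we clearly have `L(G,χ,T) = L_{Σ₀}(C,χ,T) L_{Σ₀}(D,χ,T)`. (28)"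
* p. 43: "The `μ`-invariant of `L(G,χ,T)` is zero because that is true for each factor in (28).
  Also, the `λ`-invariant of `L(G,χ,T)` is equal to `λ_{χφ,Σ₀} + λ_{χψ,Σ₀}`. The two terms are the
  `O`-coranks of `S^{Σ₀}_{C⊗χ}(ℚ_∞)` and `S^{Σ₀}_{D⊗χ}(ℚ_∞)`, respectively. Theorem (1.3) is a
  consequence of the congruence in the following theorem. We just take `χ` to be the trivial
  character. We then obtain that `λ^{anal}_{E,Σ₀} = λ_{φ,Σ₀} + λ_{ψ,Σ₀}` … The vanishing of
  `μ^{anal}_E` also follows from the congruence. … **Theorem (3.11)** Let `χ` be any even character.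
  Then we have congruence `L_{Σ₀}(E/ℚ,χ,T) ≡ u L(G,χ,T) (mod πΛ)`, where `u` is a unit in `O`."
  Proof: "… If `(p, M) = 1`, then our contention follows immediately from the `q`-expansion
  principle." (the good ordinary case; the `p ∣ M` paragraph is the multiplicative one).
* pp. 28–29 (Props. (2.6), (2.8), Cor. (2.3)): `λ_{φ,Σ₀} = dim H¹(ℚ_Σ/ℚ_∞, Φ)`,
  `λ_{ψ,Σ₀} = dim S^{Σ₀}_Ψ(ℚ_∞) = dim U` ("`S_A(ℚ_∞) = H¹_unr(ℚ_Σ/ℚ_∞, A)`", p. 29);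
  p. 9: `L_{Σ₀}(E/ℚ,T) = L(E/ℚ,T) · ∏_{ℓ∈Σ₀} 𝒫_ℓ(T)` (tree: `nonPrimitivePAdicLFunction`,
  `eulerFactorProduct`).

## The tree's vocabulary (no new definition)

`E/ℚ` on a globally minimal model `W`, `p` odd of GOOD ORDINARY reduction
(`HasGoodReductionAtPrime p`, `p ∤ a_p`), `f` the newform of `W` (`IsNewformOf`), `κ` cyclotomic,
`Φ₀ ≤ E[p]` a rational line ramified at `p` and even, `S₀ = Σ₀` finite, `p ∉ S₀ ⊇` bad places;
`ϖ ∈ ℚ` with `ϖ·Ω_E = Ω⁺_f` (GV's `L(E/ℚ,T)` is Néron-normalised, display (3), so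
`ϖ · padicLFunction f α = L(E/ℚ,T)`, `α = unitRoot W p` the unit root of `X² − a_p X + p`);
`b ∈ Λ` with `ι b = ϖ · padicLFunction f α`; then `b · eulerFactorProduct W p S₀` represents
`L_{Σ₀}(E/ℚ,T)` and the statement reads: it has unit content (`μ = 0`) and
`p^{λ} = #H¹(ℚ_Σ/ℚ_∞, Φ) · #U` (`residualLineH1`, `residualQuotSelmer` of `ResidualSelmerGroups.lean`).
-/

set_option autoImplicit false

noncomputable section

open scoped Classical AddSubgroup MatrixGroups ModularForm

open NumberField IsDedekindDomain Field WeierstrassCurve CongruenceSubgroup PowerSeries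
open Literature.NumberTheory.EllipticCurves Literature.NumberTheory.GaloisRepresentations
  Literature.NumberTheory.EllipticCurves.ModularForms
  Literature.NumberTheory.EllipticCurves.Rank1Residual

namespace Literature.NumberTheory.EllipticCurves.GreenbergVatsal2000

/-- **Greenberg–Vatsal 2000, §3 Thm. (3.11) + (28) + p. 43 at `χ = 1`, GOOD ORDINARY `p` (the
printed main case): `μ(L_{Σ₀}(E/ℚ,T)) = 0` and `λ(L_{Σ₀}(E/ℚ,T)) = dim H¹(ℚ_Σ/ℚ_∞, Φ) + dim U`.**
Thm. (3.11): "Let `χ` be any even character. Then we have congruence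
`L_{Σ₀}(E/ℚ,χ,T) ≡ u L(G,χ,T) (mod πΛ)`, where `u` is a unit in `O`" (proof, good ordinary case:
"If `(p, M) = 1`, then our contention follows immediately from the `q`-expansion principle"); (28):
"`L(G,χ,T) = L_{Σ₀}(C,χ,T) L_{Σ₀}(D,χ,T)`"; p. 43: "The `μ`-invariant of `L(G,χ,T)` is zero because
that is true for each factor in (28). Also, the `λ`-invariant of `L(G,χ,T)` is equal to
`λ_{χφ,Σ₀} + λ_{χψ,Σ₀}`. The two terms are the `O`-coranks of `S^{Σ₀}_{C⊗χ}(ℚ_∞)` and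
`S^{Σ₀}_{D⊗χ}(ℚ_∞)` … We just take `χ` to be the trivial character. We then obtain that
`λ^{anal}_{E,Σ₀} = λ_{φ,Σ₀} + λ_{ψ,Σ₀}` … The vanishing of `μ^{anal}_E` also follows from the
congruence"; pp. 28–29: these coranks are `dim H¹(ℚ_Σ/ℚ_∞, Φ)` and `dim U`; p. 42: "`φ` even and
ramified at `p` … the canonical period is the real period of `E` (up to multiplication by a `p`-adic
unit)"; §3 standing hypotheses p. 32 (`p` odd, "good ordinary or multiplicative reduction at `p`,
corresponding to the two cases `(N, p) = 1` and `(p, N/p) = 1`"); p. 3 display (3) (the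
Mazur–Swinnerton-Dyer `L(E/ℚ,T)` with the unit root `α_p` and the real Néron period `Ω_E`).
TRANSCRIPTION (good ordinary case): for `E/ℚ` globally minimal, `p ≠ 2` of good reduction with
`p ∤ a_p`, `κ` cyclotomic, `Φ₀` a rational line ramified at `p` and even, `f` the newform,
`S₀ ∌ p` finite ⊇ bad places, every `ϖ` with `ϖ·Ω_E = Ω⁺_f`, every `b ∈ Λ` with
`ι b = ϖ · padicLFunction f (unitRoot W p)`: `b·∏_{ℓ∈S₀}𝒫_ℓ` has unit content and
`p^{ord_T(b·∏𝒫 mod p)} = #residualLineH1 · #residualQuotSelmer`. The good-ordinary twin of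
`nonPrimitive_unitContent_and_lambda_eq_residual_of_lineRamifiedEven` (multiplicative case, same
printed theorem). Named reading-fact; nothing asserted.
-- TODO(general form): GV prove the congruence for every even Dirichlet character `χ` (tame at `p`);
-- only `χ = 1` is filed, with the identifications of p. 43 / pp. 28–29 / p. 42 folded in (no
-- Kubota–Leopoldt `L(G,T)` in the tree).
[cite: GreenbergVatsal2000, §3 Thm. (3.11), (28) and p. 43, with p. 3 (3), p. 32, p. 42 and §2 pp. 28–29] -/
def nonPrimitive_unitContent_and_lambda_eq_residual_of_lineRamifiedEven_goodOrd : Prop :=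
  ∀ (W : WeierstrassCurve ℚ) [W.IsGloballyMinimal] [W.IsElliptic] (p : ℕ) [Fact p.Prime]
    (κ : ZpExtension ℚ p) {N : ℕ} [NeZero N] (f : CuspForm (Gamma0 N) 2)
    (S₀ : Finset (HeightOneSpectrum (𝓞 ℚ)))
    (Φ₀ : AddSubgroup (W.geomTorsion (p : ℤ))) (hΦ : IsRationalLine W p Φ₀),
    p ≠ 2 → W.HasGoodReductionAtPrime p → ¬ (p : ℤ) ∣ W.frobeniusTrace p → κ.IsCyclotomic →
    ¬ LineUnramifiedAt W p Φ₀ → LineEven W p Φ₀ → IsNewformOf W f →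
    (∀ v ∈ S₀, ((p : ℕ) : 𝓞 ℚ) ∉ v.asIdeal) →
    (∀ v : HeightOneSpectrum (𝓞 ℚ), v ∉ S₀ → ((p : ℕ) : 𝓞 ℚ) ∉ v.asIdeal →
      W.HasGoodReductionAt v) →
    ∀ (ϖ : ℚ), (ϖ : ℝ) * W.realPeriodRat = plusPeriod f →
    ∀ (b : IwasawaAlgebra p),
      iwasawaToPowerSeries p b =
        PowerSeries.C ((ϖ : ℚ) : ℚ_[p]) * padicLFunction f (unitRoot W p : ℚ_[p]) →
      HasUnitContent (b * eulerFactorProduct W p S₀) ∧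
        p ^ (PowerSeries.map (PadicInt.toZMod (p := p)) (b * eulerFactorProduct W p S₀)).order.toNat =
          Nat.card (residualLineH1 W p κ S₀ Φ₀ hΦ) * Nat.card (residualQuotSelmer W p κ S₀ Φ₀ hΦ)

end Literature.NumberTheory.EllipticCurves.GreenbergVatsal2000

end
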